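import Mathlib
import Literature.NumberTheory.Sieve.SieveFrameworkFundamentalLemma
import Literature.NumberTheory.Sieve.ParityBarrierProofs
import Literature.NumberTheory.Sieve.ParityBarrierLevelProofs
import Literature.NumberTheory.Sieve.LevelOfDistributionProofs
import Summits.Parity.GeneralizedHardyLittlewood.Theorems.ParityLeakOneFifthPlainSplitTwistedCellSieve
import HarnessLib

/-!
# Route ParityLeakOneFifth, crux `ParityLeakSieve` (stmt-Parity-18381), skeleton `birth`:
# the Type-I comparison of stub S1, host side

For the host `a(n) = log n·1[n prime]` on `n ∈ (x, 2x]` and a fixed modulus `d` free of primes `< w`,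
the `w`-sifted sum `S_a(d) = Σ_{n prime, d ∣ n+2, P⁻(n+2) ≥ w} log n` is within
`C₁ (x/φ(d)) V_sh(w) e^{−log L/log w} + Σ_{e ∣ P(w), e ≤ L} |r(de)|` of `(x/φ(d)) V_sh(w)`
(`host_FL_le`: the uniform fundamental lemma for the sequence `k ↦ log(k−2)·1[k−2 prime ∈ (x,2x], d ∣ k]`
with the shifted-primes density), and the remainder at an odd modulus `q` is bounded by the prime
number theorem in progressions: `|Σ_{n prime ∈ (x,2x], q ∣ n+2} log n − x/φ(q)| ≤ 2E*(2x; q) + (ψ(2x) − ϑ(2x))`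
(`host_rem_le`, `E*` the tree's `primeAPError`).
-/

namespace Summit.Parity.GeneralizedHardyLittlewood.Theorems.ParityLeakOneFifth

open Finset Real
open scoped ArithmeticFunction.vonMangoldt Chebyshev
open Literature.NumberTheory.Sieve

/-! ### Re-indexing `k = n + 2` -/

/-- For `g` vanishing off `(x+2, 2x+2]`:
`Σ_{k ∈ (0, 2x+2], Q k} g(k) = Σ_{n ∈ (x, 2x], Q(n+2)} g(n+2)`. -/
theorem sum_Ioc_shift_two (x : ℕ) (Q : ℕ → Prop) [DecidablePred Q] (g : ℕ → ℝ)
    (hg : ∀ k, k ≤ x + 2 → g k = 0) :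
    ∑ k ∈ (Finset.Ioc 0 (2 * x + 2)).filter Q, g k =
      ∑ n ∈ (Finset.Ioc x (2 * x)).filter (fun n => Q (n + 2)), g (n + 2) := by
  have hsplit : (Finset.Ioc 0 (2 * x + 2)).filter Q =
      ((Finset.Ioc 0 (x + 2)).filter Q) ∪ ((Finset.Ioc (x + 2) (2 * x + 2)).filter Q) := by
    rw [← Finset.filter_union]
    congr 1
    ext k; simp only [Finset.mem_union, Finset.mem_Ioc]; omega
  have hdisj : Disjoint ((Finset.Ioc 0 (x + 2)).filter Q) ((Finset.Ioc (x + 2) (2 * x + 2)).filter Q) := by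
    rw [Finset.disjoint_left]
    intro k hk1 hk2
    rw [Finset.mem_filter, Finset.mem_Ioc] at hk1 hk2
    omega
  rw [hsplit, Finset.sum_union hdisj]
  have h0 : ∑ k ∈ (Finset.Ioc 0 (x + 2)).filter Q, g k = 0 :=
    Finset.sum_eq_zero fun k hk => hg k (Finset.mem_Ioc.1 (Finset.mem_filter.1 hk).1).2
  rw [h0, zero_add]
  have hI : Finset.Ioc (x + 2) (2 * x + 2) = (Finset.Ioc x (2 * x)).map (addRightEmbedding 2) := by
    rw [Finset.map_add_right_Ioc]
  rw [hI, Finset.filter_map, Finset.sum_map]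
  rfl

/-- For `m ≥ 2` and real `w`: all prime factors of `m` are `≥ w` iff `w ≤ minFac m`. -/
theorem forall_primeFactors_le_iff_real {m : ℕ} (hm : 2 ≤ m) (w : ℝ) :
    (∀ p ∈ m.primeFactors, w ≤ (p : ℝ)) ↔ w ≤ (m.minFac : ℝ) := by
  constructor
  · intro h
    exact h _ (Nat.mem_primeFactors.2 ⟨Nat.minFac_prime (by omega), Nat.minFac_dvd m, by omega⟩)
  · intro h p hp
    obtain ⟨hpr, hdvd, -⟩ := Nat.mem_primeFactors.1 hp
    exact h.trans (by exact_mod_cast Nat.minFac_le_of_dvd hpr.two_le hdvd)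

/-! ### The host sequence and the fundamental lemma -/

/-- **The fundamental lemma for the host sequence in a progression.** There is `C₁ > 0` such that
for all `x d : ℕ` (`d ≥ 1`) and reals `2 ≤ w ≤ L` with `d` free of prime factors `< w`:
`|S_a(d) − (x/φ(d)) V_sh(w)| ≤ C₁ (x/φ(d)) V_sh(w) e^{−log L/log w} + Σ_{e ∣ P(w), e ≤ L} |r(d, e)|`, where
`S_a(d) = Σ_{n ∈ (x,2x] prime, d ∣ n+2, w ≤ P⁻(n+2)} log n` and
`r(d, e) = Σ_{n ∈ (x,2x] prime, d ∣ n+2, e ∣ n+2} log n − g(e)·x/φ(d)`, `g` the shifted-primes density. -/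
theorem host_FL_le : ∃ C₁ : ℝ, 0 < C₁ ∧ ∀ (x d : ℕ) (w L : ℝ), 0 < d → 2 ≤ w → w ≤ L →
    (∀ p : ℕ, p.Prime → (p : ℝ) < w → ¬ p ∣ d) →
    |(∑ n ∈ (Finset.Ioc x (2 * x)).filter (fun n : ℕ => n.Prime ∧ d ∣ n + 2 ∧ w ≤ ((n + 2).minFac : ℝ)),
        Real.log (n : ℝ)) -
      (x : ℝ) / (Nat.totient d : ℝ) *
        ∏ p ∈ (Finset.range ⌈w⌉₊).filter (fun p : ℕ => p.Prime ∧ p ≠ 2), (1 - 1 / ((p : ℝ) - 1))| ≤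
      C₁ * ((x : ℝ) / (Nat.totient d : ℝ)) *
        (∏ p ∈ (Finset.range ⌈w⌉₊).filter (fun p : ℕ => p.Prime ∧ p ≠ 2), (1 - 1 / ((p : ℝ) - 1))) *
        Real.exp (-(Real.log L / Real.log w)) +
      ∑ e ∈ (primesProdBelow w).divisors.filter (fun e : ℕ => (e : ℝ) ≤ L),
        |(∑ n ∈ (Finset.Ioc x (2 * x)).filter (fun n : ℕ => n.Prime ∧ d ∣ n + 2 ∧ e ∣ n + 2),
            Real.log (n : ℝ)) - shiftedPrimesDensity 2 e * ((x : ℝ) / (Nat.totient d : ℝ))| := by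
  obtain ⟨K, hdim⟩ := hasSieveDimension_shiftedPrimes_two_one_holds
  obtain ⟨C₁, hC₁, hFL⟩ := SieveSequence.fundamental_lemma_uniform_holds 1 K
  refine ⟨C₁, hC₁, fun x d w L hd hw2 hwL hdw => ?_⟩
  -- the sequence `k ↦ log(k−2)·1[x+2 < k ≤ 2x+2, k−2 prime, d ∣ k]`
  let 𝒜 : SieveSequence :=
    { a := fun k => if x + 2 < k ∧ k ≤ 2 * x + 2 ∧ (k - 2).Prime ∧ d ∣ k then Real.log ((k - 2 : ℕ) : ℝ) else 0
      a_nonneg := fun k => by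
        split_ifs with h
        · exact Real.log_nonneg (by exact_mod_cast (by omega : 1 ≤ k - 2))
        · exact le_rfl
      size := fun _ => (x : ℝ) / (Nat.totient d : ℝ)
      density := shiftedPrimesDensity 2
      density_mult := isMultiplicative_shiftedPrimesDensity 2 }
  have hA : ∀ k : ℕ, 𝒜.a k = if x + 2 < k ∧ k ≤ 2 * x + 2 ∧ (k - 2).Prime ∧ d ∣ k then
      Real.log ((k - 2 : ℕ) : ℝ) else 0 := fun k => rfl
  have hdimA : HasSieveDimension 𝒜.density 1 K := hdim
  have hdensA : 𝒜.densityProduct (primesProdBelow w) =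
      ∏ p ∈ (Finset.range ⌈w⌉₊).filter (fun p : ℕ => p.Prime ∧ p ≠ 2), (1 - 1 / ((p : ℝ) - 1)) :=
    densityProduct_shiftedPrimes_two w
  have hsize : 𝒜.size (((2 * x + 2 : ℕ) : ℝ)) = (x : ℝ) / (Nat.totient d : ℝ) := rfl
  -- generic evaluation of filtered sums of `𝒜.a`
  have hsumA : ∀ (Q : ℕ → Prop) [DecidablePred Q],
      ∑ k ∈ (Finset.Ioc 0 (2 * x + 2)).filter Q, 𝒜.a k =
        ∑ n ∈ (Finset.Ioc x (2 * x)).filter (fun n : ℕ => n.Prime ∧ d ∣ n + 2 ∧ Q (n + 2)),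
          Real.log (n : ℝ) := by
    intro Q _
    rw [sum_Ioc_shift_two x Q 𝒜.a (fun k hk => by rw [hA, if_neg]; omega)]
    rw [Finset.sum_filter, Finset.sum_filter]
    refine Finset.sum_congr rfl fun n hn => ?_
    rw [Finset.mem_Ioc] at hn
    simp only [hA, Nat.add_sub_cancel]
    by_cases hQ : Q (n + 2)
    · by_cases hP : n.Prime ∧ d ∣ n + 2
      · rw [if_pos hQ, if_pos ⟨by omega, by omega, hP.1, hP.2⟩, if_pos ⟨hP.1, hP.2, hQ⟩]
      · rw [if_pos hQ, if_neg, if_neg]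
        · rintro ⟨h1, h2, -⟩; exact hP ⟨h1, h2⟩
        · rintro ⟨-, -, h1, h2⟩; exact hP ⟨h1, h2⟩
    · rw [if_neg hQ, if_neg]
      rintro ⟨-, -, h⟩; exact hQ h
  -- the sifted sum
  have hsifted : 𝒜.sifted (((2 * x + 2 : ℕ) : ℝ)) (primesProdBelow w) =
      ∑ n ∈ (Finset.Ioc x (2 * x)).filter (fun n : ℕ => n.Prime ∧ d ∣ n + 2 ∧ w ≤ ((n + 2).minFac : ℝ)),
        Real.log (n : ℝ) := by
    rw [SieveSequence.sifted, Nat.floor_natCast, hsumA]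
    refine Finset.sum_congr ?_ fun _ _ => rfl
    refine Finset.filter_congr fun n hn => ?_
    rw [Finset.mem_Ioc] at hn
    have hm0 : n + 2 ≠ 0 := by omega
    rw [← rough_iff_coprime hm0 w, forall_primeFactors_le_iff_real (by omega : 2 ≤ n + 2)]
  -- the remainders
  have hrem : ∀ e : ℕ, 𝒜.remainder e (((2 * x + 2 : ℕ) : ℝ)) =
      (∑ n ∈ (Finset.Ioc x (2 * x)).filter (fun n : ℕ => n.Prime ∧ d ∣ n + 2 ∧ e ∣ n + 2),
          Real.log (n : ℝ)) - shiftedPrimesDensity 2 e * ((x : ℝ) / (Nat.totient d : ℝ)) := by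
    intro e
    rw [SieveSequence.remainder, SieveSequence.congrSum, Nat.floor_natCast, hsumA]
  have hmain := hFL 𝒜 hdimA (((2 * x + 2 : ℕ) : ℝ)) w L hw2 hwL (by rw [hsize]; positivity)
  rw [hsifted, hdensA, hsize] at hmain
  simp only [hrem] at hmain
  exact hmain

/-! ### The remainder at one modulus: primes in a progression -/

/-- `−2` is a unit modulo an odd `q`. -/
theorem isUnit_neg_two_of_odd {q : ℕ} (hq : ¬ 2 ∣ q) : IsUnit (-2 : ZMod q) := by
  have hcop : Nat.Coprime 2 q := Nat.prime_two.coprime_iff_not_dvd.2 hq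
  have h2 : IsUnit ((2 : ℕ) : ZMod q) := (ZMod.unitOfCoprime 2 hcop).isUnit
  push_cast at h2
  exact h2.neg

/-- `q ∣ n + 2` iff `n ≡ −2 (mod q)` in `ZMod q`. -/
theorem dvd_add_two_iff_cast (q n : ℕ) : q ∣ n + 2 ↔ (n : ZMod q) = -2 := by
  rw [← ZMod.natCast_eq_zero_iff, Nat.cast_add, Nat.cast_ofNat, add_eq_zero_iff_eq_neg]

/-- **The remainder of the host at an odd modulus.** For odd `q ≥ 1` and `x ≥ 1`:
`|Σ_{n ∈ (x,2x] prime, q ∣ n+2} log n − x/φ(q)| ≤ 2 E*(2x; q) + (ψ(2x) − ϑ(2x))`. -/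
theorem host_rem_le {q : ℕ} (hq : 0 < q) (hodd : ¬ 2 ∣ q) {x : ℕ} (hx : 1 ≤ x) :
    |(∑ n ∈ (Finset.Ioc x (2 * x)).filter (fun n : ℕ => n.Prime ∧ q ∣ n + 2), Real.log (n : ℝ)) -
        (x : ℝ) / (Nat.totient q : ℝ)| ≤
      2 * primeAPError ((2 * x : ℕ) : ℝ) q + (ψ ((2 * x : ℕ) : ℝ) - θ ((2 * x : ℕ) : ℝ)) := by
  obtain ⟨u, hu⟩ := isUnit_neg_two_of_odd (q := q) hodd
  -- `Σ_{n ∈ (x,2x], n ≡ -2} Λ n = ψ(2x; q, -2) − ψ(x; q, -2)`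
  obtain ⟨a, ha⟩ : ∃ a : ZMod q, a = -2 := ⟨_, rfl⟩
  rw [← ha] at hu
  have hψ : ∀ N : ℕ, LevelOfDistribution.chebyshevPsiMod q a N =
      ∑ n ∈ Finset.range (N + 1), apIndicator q a n * Λ n := fun N => chebyshevPsiMod_natCast q a N
  have hdiff : LevelOfDistribution.chebyshevPsiMod q a ((2 * x : ℕ) : ℝ) -
      LevelOfDistribution.chebyshevPsiMod q a ((x : ℕ) : ℝ) =
      ∑ n ∈ Finset.Ioc x (2 * x), apIndicator q a n * Λ n := by
    rw [hψ, hψ]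
    have hI : Finset.range (2 * x + 1) = Finset.range (x + 1) ∪ Finset.Ioc x (2 * x) := by
      ext n; simp only [Finset.mem_union, Finset.mem_range, Finset.mem_Ioc]; omega
    have hd : Disjoint (Finset.range (x + 1)) (Finset.Ioc x (2 * x)) := by
      rw [Finset.disjoint_left]; intro n h1 h2
      rw [Finset.mem_range] at h1; rw [Finset.mem_Ioc] at h2; omega
    rw [hI, Finset.sum_union hd]; ring
  -- split the window sum into primes and non-primes
  have hsplit : ∑ n ∈ Finset.Ioc x (2 * x), apIndicator q a n * Λ n =
      (∑ n ∈ (Finset.Ioc x (2 * x)).filter (fun n : ℕ => n.Prime ∧ q ∣ n + 2), Real.log (n : ℝ)) +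
      ∑ n ∈ (Finset.Ioc x (2 * x)).filter (fun n : ℕ => ¬ n.Prime), apIndicator q a n * Λ n := by
    rw [← Finset.sum_filter_add_sum_filter_not (Finset.Ioc x (2 * x)) (fun n : ℕ => n.Prime)]
    congr 1
    rw [Finset.sum_filter, Finset.sum_filter]
    refine Finset.sum_congr rfl fun n _ => ?_
    by_cases hp : n.Prime
    · rw [if_pos hp, ArithmeticFunction.vonMangoldt_apply_prime hp, apIndicator]
      by_cases hdq : q ∣ n + 2
      · have hc : (n : ZMod q) = a := by rw [ha]; exact (dvd_add_two_iff_cast q n).1 hdq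
        rw [if_pos hc, if_pos ⟨hp, hdq⟩, one_mul]
      · have hc : ¬ (n : ZMod q) = a := fun h => hdq ((dvd_add_two_iff_cast q n).2 (by rw [← ha]; exact h))
        rw [if_neg hc, if_neg (fun h => hdq h.2), zero_mul]
    · rw [if_neg hp, if_neg (fun h => hp h.1)]
  -- the non-prime part is in `[0, ψ(2x) − θ(2x)]`
  have hnp0 : 0 ≤ ∑ n ∈ (Finset.Ioc x (2 * x)).filter (fun n : ℕ => ¬ n.Prime), apIndicator q a n * Λ n :=
    Finset.sum_nonneg fun n _ => mul_nonneg (apIndicator_nonneg q a n) ArithmeticFunction.vonMangoldt_nonneg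
  have hnp1 : ∑ n ∈ (Finset.Ioc x (2 * x)).filter (fun n : ℕ => ¬ n.Prime), apIndicator q a n * Λ n ≤
      ψ ((2 * x : ℕ) : ℝ) - θ ((2 * x : ℕ) : ℝ) := by
    rw [← sum_vonMangoldt_not_prime (2 * x)]
    calc ∑ n ∈ (Finset.Ioc x (2 * x)).filter (fun n : ℕ => ¬ n.Prime), apIndicator q a n * Λ n
        ≤ ∑ n ∈ (Finset.Ioc x (2 * x)).filter (fun n : ℕ => ¬ n.Prime), Λ n :=
          Finset.sum_le_sum fun n _ => mul_le_of_le_one_left ArithmeticFunction.vonMangoldt_nonneg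
            (apIndicator_le_one q a n)
      _ ≤ ∑ n ∈ (Finset.Ioc 0 (2 * x)).filter (fun n : ℕ => ¬ n.Prime), Λ n := by
          refine Finset.sum_le_sum_of_subset_of_nonneg ?_ fun _ _ _ => ArithmeticFunction.vonMangoldt_nonneg
          intro n hn
          rw [Finset.mem_filter, Finset.mem_Ioc] at hn ⊢
          exact ⟨⟨by omega, hn.1.2⟩, hn.2⟩
  -- the two prime number theorem errors
  have hq0 : q ≠ 0 := hq.ne'
  have hx1 : (1 : ℝ) ≤ ((x : ℕ) : ℝ) := by exact_mod_cast hx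
  have hx2 : ((x : ℕ) : ℝ) ≤ ((2 * x : ℕ) : ℝ) := by exact_mod_cast (by omega : x ≤ 2 * x)
  have h2x1 : (1 : ℝ) ≤ ((2 * x : ℕ) : ℝ) := hx1.trans hx2
  have hE2 := abs_sub_le_primeAPError (x := ((2 * x : ℕ) : ℝ)) hq0 h2x1 le_rfl u
  have hE1 := abs_sub_le_primeAPError (x := ((2 * x : ℕ) : ℝ)) hq0 hx1 hx2 u
  rw [hu] at hE2 hE1
  have hφ : ((2 * x : ℕ) : ℝ) / (Nat.totient q : ℝ) - ((x : ℕ) : ℝ) / (Nat.totient q : ℝ) =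
      (x : ℝ) / (Nat.totient q : ℝ) := by
    have h2x : ((2 * x : ℕ) : ℝ) = 2 * (x : ℝ) := by push_cast; ring
    rw [h2x]; ring
  have e : (∑ n ∈ (Finset.Ioc x (2 * x)).filter (fun n : ℕ => n.Prime ∧ q ∣ n + 2), Real.log (n : ℝ)) -
      (x : ℝ) / (Nat.totient q : ℝ) =
      (LevelOfDistribution.chebyshevPsiMod q a ((2 * x : ℕ) : ℝ) - ((2 * x : ℕ) : ℝ) / (Nat.totient q : ℝ)) -
      (LevelOfDistribution.chebyshevPsiMod q a ((x : ℕ) : ℝ) - ((x : ℕ) : ℝ) / (Nat.totient q : ℝ)) -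
      ∑ n ∈ (Finset.Ioc x (2 * x)).filter (fun n : ℕ => ¬ n.Prime), apIndicator q a n * Λ n := by
    have h := hdiff; rw [hsplit] at h; linarith
  rw [e]
  calc |LevelOfDistribution.chebyshevPsiMod q a ((2 * x : ℕ) : ℝ) - ((2 * x : ℕ) : ℝ) / (Nat.totient q : ℝ) -
        (LevelOfDistribution.chebyshevPsiMod q a ((x : ℕ) : ℝ) - ((x : ℕ) : ℝ) / (Nat.totient q : ℝ)) -
        ∑ n ∈ (Finset.Ioc x (2 * x)).filter (fun n : ℕ => ¬ n.Prime), apIndicator q a n * Λ n|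
      ≤ |LevelOfDistribution.chebyshevPsiMod q a ((2 * x : ℕ) : ℝ) - ((2 * x : ℕ) : ℝ) / (Nat.totient q : ℝ)| +
        |LevelOfDistribution.chebyshevPsiMod q a ((x : ℕ) : ℝ) - ((x : ℕ) : ℝ) / (Nat.totient q : ℝ)| +
        |∑ n ∈ (Finset.Ioc x (2 * x)).filter (fun n : ℕ => ¬ n.Prime), apIndicator q a n * Λ n| := by
          refine (abs_sub _ _).trans (add_le_add (abs_sub _ _) le_rfl)
    _ ≤ primeAPError ((2 * x : ℕ) : ℝ) q + primeAPError ((2 * x : ℕ) : ℝ) q +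
        (ψ ((2 * x : ℕ) : ℝ) - θ ((2 * x : ℕ) : ℝ)) := by
          refine add_le_add (add_le_add hE2 hE1) ?_
          rw [abs_of_nonneg hnp0]; exact hnp1
    _ = _ := by ring

end Summit.Parity.GeneralizedHardyLittlewood.Theorems.ParityLeakOneFifth
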